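import Mathlib

/-!
# Dimock, *The renormalization group according to Balaban* I, §4.9 "derivatives", LEMMA 22 (`\label{smooth}`): Cauchy
# bounds turn the analyticity of `μ*_k`, `E*_k` in `(μ_k, E_k)` and the bounds (newt) into bounds on the partial
# derivatives on the half-size region — PROVED from Mathlib's Cauchy estimate, with the `λ_k`-power arithmetic explicit

**Citation header (reproduction of PUBLISHED work; template of the Bałaban lattice Yang–Mills cell).**
J. Dimock, *The renormalization group according to Balaban I. Small fields*, Rev. Math. Phys. **25** (2013) 1330010
(= arXiv:1108.1335v2) [Dimock2013], §4.9 "derivatives" TeX L2675–2733: the bounds (newt) L2681–2686, the analyticity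
remark L2687–2691, LEMMA `\label{smooth}` (= LEMMA 22 of the global counter `\newtheorem{lem}[thm]{Lemma}`: #21 =
`cluster0` L2510, #22 = `smooth` L2693) L2693–2703 with its proof L2706–2733 (TeX source held by the cell,
`inputs/files/dimock/src/1108.1335/1108.1335.tex`, 7382e6540dded9be).  Dimock's papers are published and refereed and are
the cell's TEMPLATE, not manuscripts under audit; no quantity of the Bałaban series is touched.

**What the paper prints (verbatim).**  L2677–2691: *"The previous proof was carried out under the assumption that λ_k
is small and μ_k ∈ ℝ, E_k ∈ Re(𝒦_k^{norm}) satisfy |μ_k| ≤ λ_k^{1/2} and ‖E_k‖_{k,κ} ≤ 1. In this domain μ*_k =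
μ*_k(λ_k, μ_k, E_k) and E_k* = E_k*(λ_k, μ_k, E_k) satisfy the bounds |μ_k*| ≤ 𝒪(1)L³λ_k^{3/4−4ε}, ‖E_k*‖_{k,κ} ≤
𝒪(1)L³λ_k^{1/4−10ε} (newt)  However the proof works as well for μ_k ∈ ℂ, E_k ∈ 𝒦_k^{norm} with exactly the same bounds,
and one can show that μ_k*, E_k* are analytic functions of μ_k, E_k on this domain. This means we can use Cauchy bounds
to get estimates on partial derivatives in a slightly smaller region."*  LEMMA 22 (L2693–2703): *"In the region |μ_k| ≤
½λ_k^{1/2} and ‖E_k‖_k ≤ ½ we have |∂μ_k*/∂μ_k| ≤ 𝒪(1)L³λ_k^{1/4−4ε}, ‖∂μ_k*/∂E_k‖ ≤ 𝒪(1)L³λ_k^{3/4−4ε}, |∂E_k*/∂μ_k| ≤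
𝒪(1)L³λ_k^{−1/4−10ε}, ‖∂E_k*/∂E_k‖ ≤ 𝒪(1)L³λ_k^{1/4−10ε}"*.  Proof (L2706–2733): *"We have ∂μ_k*/∂μ_k = d/dt[μ_k*(λ_k,
μ_k + t, E_k)]_{t=0} = (2πi)^{−1}∫_{|t|=½λ_k^{1/2}} t^{−2} μ_k*(λ_k, μ_k + t, E_k)dt whence |∂μ_k*/∂μ_k| ≤
𝒪(1)λ_k^{−1/2}(L³λ_k^{3/4−4ε}) ≤ 𝒪(1)L³λ_k^{1/4−4ε}  We also have for ‖Ė‖_{k,κ} ≤ 1  <∂μ_k*/∂E_k, Ė> ≡ d/dt[μ_k*(λ_k, μ_k,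
E_k + tĖ)]_{t=0} = (2πi)^{−1}∫_{|t|=½} t^{−2} μ_k*(λ_k, μ_k, E_k + tĖ)dt whence |<∂μ_k*/∂E_k, Ė>| ≤ 𝒪(1)L³λ_k^{3/4−4ε} … The
estimates on the derivatives of E*_k are similar."*

**What is reproduced here (kernel-checked, zero `sorry`; Mathlib only).**  Values in any complex Banach space `F` (the
print: `ℂ` for `μ*_k`, `𝒦_k^{norm}` for `E*_k`), parameters in `ℂ` (`μ_k`) or in any complex normed space `𝒦` (`E_k`).
* §1 **the Cauchy bound on the half-radius region**: `norm_deriv_le_of_closedBall` — `f` analytic in the disc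
  `|z − c| < R` and continuous on its closure, `‖f‖ ≤ A` there ⟹ `‖f′(μ)‖ ≤ 2A/R` for every `|μ − c| ≤ R/2` (Mathlib's
  `Complex.norm_deriv_le_of_forall_mem_sphere_norm_le` on the disc of radius `R/2` about `μ`, which lies inside).
* §2 **the `μ_k`-derivatives**: `deriv_bound_rpow` — with `R = λ^{1/2}` and `A = B·λ^a`: `‖f′(μ)‖ ≤ 2B·λ^{a−1/2}` for
  `|μ| ≤ ½λ^{1/2}` (*"𝒪(1)λ_k^{−1/2}(L³λ_k^{3/4−4ε})"*); instances **`lemma22_mu_mu`** (`a = 3/4 − 4ε ↦ 1/4 − 4ε`: the bound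
  on `∂μ*_k/∂μ_k`) and **`lemma22_E_mu`** (`a = 1/4 − 10ε ↦ −1/4 − 10ε`: the bound on `∂E*_k/∂μ_k`), `B = 𝒪(1)L³`.
* §3 **the `E_k`-derivatives (directional)**: `norm_deriv_line_le` — `Φ` analytic on a set containing the closed unit
  ball of `𝒦`, `‖Φ‖ ≤ A` on that ball, `‖E‖ ≤ ½`, `‖Ė‖ ≤ 1` ⟹ the Gateaux derivative `d/dt Φ(E + tĖ)|_{t=0}` has norm
  `≤ 2A` (the circle `|t| = ½` stays in the unit ball) — **`lemma22_mu_E`**/**`lemma22_E_E`** are this with `A =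
  𝒪(1)L³λ^{3/4−4ε}` resp. `𝒪(1)L³λ^{1/4−10ε}` (nothing to compute: *"≤ 𝒪(1)L³λ_k^{3/4−4ε}"* with `𝒪(1) ↦ 2·𝒪(1)`);
  (v1.1) the OPERATOR-NORM form of L2728–2732 packaged: `opNorm_fderiv_le` (`U` open ⟹ `‖DΦ(E)‖ ≤ 2A` for `‖E‖ ≤ ½`,
  from the directional bounds by rescaling `Ė = v/‖v‖`) and `lemma22_opNorm` (`A = Bλ^a`).

**Readings (declared).**  (i) "analytic on the domain |μ_k| ≤ λ_k^{1/2}" = differentiable on the open disc and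
continuous on the closed one (`DiffContOnCl`), resp. differentiable on some set `U ⊇` closed unit ball for the
`E_k`-variable; (ii) the operator norm `‖∂μ*_k/∂E_k‖ = sup_{‖Ė‖≤1}|<∂μ*_k/∂E_k, Ė>|` (L2728–2732): v1 proves the bound for
every direction `Ė` with `‖Ė‖ ≤ 1`; v1.1 packages it as the operator norm of the Fréchet derivative (`U` open); (iii) constants: the print's `𝒪(1)` on the
right is `2×` the `𝒪(1)` of (newt) (Cauchy on half the radius), made explicit.

**What is NOT claimed.**  The analyticity of `μ*_k`, `E*_k` itself (*"one can show"*, L2689–2690) and the bounds (newt) —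
hypotheses here; the norm `‖·‖_{k,κ}`; anything of B1–B16 (TEMPLATE.md §4.1 row «D1 §4.9» ↔ B12: the Lipschitz control
of `β_{j+1}(g_j)` — grade noted there; untouched).  NOT summit progress; NOT a statement about any Bałaban paper; NOT
continuum; NOT Clay.  Unit `b2b-balaban-template` gen 31 (journal CLAIM D1-LEMMA22-CAUCHY-KERNEL).

**Version.**  v1.1 — ADDITIVE to v1 (p204632, commit b7d0cc16e4f9): + `opNorm_fderiv_le`, `lemma22_opNorm` (private
`deriv_line_eq_fderiv`); reading (ii) updated; every v1 declaration byte-identical (unit `b2b-balaban-template` gen 31,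
journal CLAIM D1-LEMMA22-OPNORM-KERNEL).
-/

noncomputable section

open Metric Set Complex

namespace Literature.MathematicalPhysics.QuantumFieldTheory.Dimock2011to13.CauchyDerivativeBounds

variable {F : Type*} [NormedAddCommGroup F] [NormedSpace ℂ F]

/-! ## §1 The Cauchy bound on the half-radius region -/

/-- **Cauchy bound, half radius**: `f` differentiable on the disc `|z − c| < R`, continuous on its closure, `‖f z‖ ≤ A`
for `|z − c| ≤ R`; then `‖f′(μ)‖ ≤ 2A/R` whenever `|μ − c| ≤ R/2` (*"we can use Cauchy bounds to get estimates on partial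
derivatives in a slightly smaller region"*; the contour `|t| = ½λ_k^{1/2}` of L2710). [cite: Dimock2013, §4.9 L2687–2691 and
Lemma smooth proof L2706–2717 (arXiv:1108.1335v2 TeX)] -/
theorem norm_deriv_le_of_closedBall {f : ℂ → F} {c μ : ℂ} {R A : ℝ} (hR : 0 < R)
    (hd : DiffContOnCl ℂ f (ball c R)) (hA : ∀ z ∈ closedBall c R, ‖f z‖ ≤ A) (hμ : dist μ c ≤ R / 2) :
    ‖deriv f μ‖ ≤ 2 * A / R := by
  have hR2 : 0 < R / 2 := by linarith
  have hsub : closedBall μ (R / 2) ⊆ closedBall c R := by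
    intro z hz
    rw [mem_closedBall] at hz ⊢
    linarith [dist_triangle z μ c]
  have hball : ball μ (R / 2) ⊆ ball c R := by
    intro z hz
    rw [mem_ball] at hz ⊢
    linarith [dist_triangle z μ c]
  have hd' : DiffContOnCl ℂ f (ball μ (R / 2)) := by
    refine DiffContOnCl.mk_ball (hd.differentiableOn.mono hball) ?_
    refine hd.continuousOn.mono ?_
    rw [closure_ball c hR.ne']
    exact hsub
  have h := Complex.norm_deriv_le_of_forall_mem_sphere_norm_le hR2 hd'
    (fun z hz => hA z (hsub (sphere_subset_closedBall hz)))
  calc ‖deriv f μ‖ ≤ A / (R / 2) := h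
    _ = 2 * A / R := by field_simp

/-! ## §2 The `μ_k`-derivatives: radius `λ^{1/2}`, bound `B·λ^a` -/

/-- the `λ`-power arithmetic of L2714–2716: radius `R = λ^{1/2}`, bound `A = Bλ^a` ⟹ `‖f′(μ)‖ ≤ 2Bλ^{a−1/2}` on `|μ| ≤
½λ^{1/2}` (*"≤ 𝒪(1)λ_k^{−1/2}(L³λ_k^{3/4−4ε})"*). [cite: Dimock2013, §4.9 Lemma smooth proof L2706–2717 (arXiv:1108.1335v2
TeX)] -/
theorem deriv_bound_rpow {f : ℂ → F} {lam B a : ℝ} (hlam : 0 < lam)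
    (hd : DiffContOnCl ℂ f (ball 0 (lam ^ (1 / 2 : ℝ))))
    (hA : ∀ z ∈ closedBall (0 : ℂ) (lam ^ (1 / 2 : ℝ)), ‖f z‖ ≤ B * lam ^ a)
    {μ : ℂ} (hμ : ‖μ‖ ≤ lam ^ (1 / 2 : ℝ) / 2) :
    ‖deriv f μ‖ ≤ 2 * B * lam ^ (a - 1 / 2) := by
  have hR : 0 < lam ^ (1 / 2 : ℝ) := Real.rpow_pos_of_pos hlam _
  have hμ' : dist μ 0 ≤ lam ^ (1 / 2 : ℝ) / 2 := by rwa [dist_zero_right]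
  have h := norm_deriv_le_of_closedBall hR hd hA hμ'
  rw [Real.rpow_sub hlam, show 2 * B * (lam ^ a / lam ^ (1 / 2 : ℝ)) = 2 * (B * lam ^ a) / lam ^ (1 / 2 : ℝ) by ring]
  exact h

/-- **LEMMA 22, `|∂μ*_k/∂μ_k| ≤ 𝒪(1)L³λ_k^{1/4−4ε}`**: if `t ↦ μ*_k(λ_k, t, E_k)` is analytic on `|t| < λ_k^{1/2}`, continuous
on the closed disc and bounded there by `B·λ_k^{3/4−4ε}` (`B = 𝒪(1)L³`, (newt)), then its derivative at any `|μ_k| ≤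
½λ_k^{1/2}` is at most `2B·λ_k^{1/4−4ε}`. [cite: Dimock2013, §4.9 Lemma smooth L2693–2698 with proof L2706–2717
(arXiv:1108.1335v2 TeX)] -/
theorem lemma22_mu_mu {f : ℂ → F} {lam B ε : ℝ} (hlam : 0 < lam)
    (hd : DiffContOnCl ℂ f (ball 0 (lam ^ (1 / 2 : ℝ))))
    (hA : ∀ z ∈ closedBall (0 : ℂ) (lam ^ (1 / 2 : ℝ)), ‖f z‖ ≤ B * lam ^ (3 / 4 - 4 * ε))
    {μ : ℂ} (hμ : ‖μ‖ ≤ lam ^ (1 / 2 : ℝ) / 2) :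
    ‖deriv f μ‖ ≤ 2 * B * lam ^ (1 / 4 - 4 * ε) := by
  have h := deriv_bound_rpow hlam hd hA hμ
  rwa [show (3 / 4 - 4 * ε) - 1 / 2 = 1 / 4 - 4 * ε by ring] at h

/-- **LEMMA 22, `|∂E*_k/∂μ_k| ≤ 𝒪(1)L³λ_k^{−1/4−10ε}`** (*"The estimates on the derivatives of E*_k are similar"*): bound
`B·λ_k^{1/4−10ε}` on the disc of radius `λ_k^{1/2}` ⟹ derivative `≤ 2B·λ_k^{−1/4−10ε}` on the half disc. [cite: Dimock2013,
§4.9 Lemma smooth L2700–2702 with proof L2733 (arXiv:1108.1335v2 TeX)] -/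
theorem lemma22_E_mu {f : ℂ → F} {lam B ε : ℝ} (hlam : 0 < lam)
    (hd : DiffContOnCl ℂ f (ball 0 (lam ^ (1 / 2 : ℝ))))
    (hA : ∀ z ∈ closedBall (0 : ℂ) (lam ^ (1 / 2 : ℝ)), ‖f z‖ ≤ B * lam ^ (1 / 4 - 10 * ε))
    {μ : ℂ} (hμ : ‖μ‖ ≤ lam ^ (1 / 2 : ℝ) / 2) :
    ‖deriv f μ‖ ≤ 2 * B * lam ^ (-(1 / 4) - 10 * ε) := by
  have h := deriv_bound_rpow hlam hd hA hμ
  rwa [show (1 / 4 - 10 * ε) - 1 / 2 = -(1 / 4) - 10 * ε by ring] at h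

/-! ## §3 The `E_k`-derivatives: the circle `|t| = ½` in the unit ball of `𝒦_k` -/

section Directional

variable {𝒦 : Type*} [NormedAddCommGroup 𝒦] [NormedSpace ℂ 𝒦]

/-- the line `t ↦ E + tĖ` keeps the disc `|t| ≤ ½` inside the closed unit ball when `‖E‖ ≤ ½`, `‖Ė‖ ≤ 1`. [folklore] -/
private theorem line_mem_closedBall {E Edot : 𝒦} (hE : ‖E‖ ≤ 1 / 2) (hEdot : ‖Edot‖ ≤ 1) {t : ℂ} (ht : ‖t‖ ≤ 1 / 2) :
    E + t • Edot ∈ closedBall (0 : 𝒦) 1 := by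
  rw [mem_closedBall, dist_zero_right]
  calc ‖E + t • Edot‖ ≤ ‖E‖ + ‖t • Edot‖ := norm_add_le _ _
    _ = ‖E‖ + ‖t‖ * ‖Edot‖ := by rw [norm_smul]
    _ ≤ 1 / 2 + 1 / 2 * 1 := by gcongr
    _ = 1 := by norm_num

/-- **the directional Cauchy bound**: `Φ` differentiable on a set `U` containing the closed unit ball of `𝒦`, `‖Φ‖ ≤ A` on
that ball, `‖E‖ ≤ ½`, `‖Ė‖ ≤ 1` ⟹ `‖d/dt Φ(E + tĖ)|_{t=0}‖ ≤ 2A` (Cauchy on `|t| = ½`: *"(2πi)^{−1}∫_{|t|=½} t^{−2}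
μ_k*(λ_k, μ_k, E_k + tĖ)dt"*). [cite: Dimock2013, §4.9 Lemma smooth proof L2718–2732 (arXiv:1108.1335v2 TeX)] -/
theorem norm_deriv_line_le {Φ : 𝒦 → F} {U : Set 𝒦} (hU : closedBall (0 : 𝒦) 1 ⊆ U) (hΦ : DifferentiableOn ℂ Φ U)
    {A : ℝ} (hA : ∀ x ∈ closedBall (0 : 𝒦) 1, ‖Φ x‖ ≤ A) {E Edot : 𝒦} (hE : ‖E‖ ≤ 1 / 2) (hEdot : ‖Edot‖ ≤ 1) :
    ‖deriv (fun t : ℂ => Φ (E + t • Edot)) 0‖ ≤ 2 * A := by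
  set g : ℂ → F := fun t => Φ (E + t • Edot) with hg
  have hline : DifferentiableOn ℂ (fun t : ℂ => E + t • Edot) ((fun t : ℂ => E + t • Edot) ⁻¹' U) := by
    fun_prop
  have hgd : DifferentiableOn ℂ g ((fun t : ℂ => E + t • Edot) ⁻¹' U) :=
    hΦ.comp hline fun t ht => ht
  have hsub : closedBall (0 : ℂ) (1 / 2) ⊆ (fun t : ℂ => E + t • Edot) ⁻¹' U := by
    intro t ht
    rw [mem_closedBall, dist_zero_right] at ht
    exact hU (line_mem_closedBall hE hEdot ht)
  have hd : DiffContOnCl ℂ g (ball 0 (1 / 2)) := hgd.diffContOnCl_ball hsub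
  have h := Complex.norm_deriv_le_of_forall_mem_sphere_norm_le (by norm_num : (0 : ℝ) < 1 / 2) hd
    (C := A) (fun t ht => by
      have ht' : ‖t‖ ≤ 1 / 2 := by
        have := sphere_subset_closedBall ht
        rw [mem_closedBall, dist_zero_right] at this
        exact this
      exact hA _ (line_mem_closedBall hE hEdot ht'))
  calc ‖deriv g 0‖ ≤ A / (1 / 2) := h
    _ = 2 * A := by ring

/-- **LEMMA 22, `‖∂μ*_k/∂E_k‖ ≤ 𝒪(1)L³λ_k^{3/4−4ε}`**: with `A = B·λ_k^{3/4−4ε}` (the (newt) bound of `μ*_k` on the unit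
ball `‖E_k‖ ≤ 1`), every directional derivative at `‖E_k‖ ≤ ½` along `‖Ė‖ ≤ 1` is `≤ 2B·λ_k^{3/4−4ε}` (reading (ii): this IS
the operator-norm bound). [cite: Dimock2013, §4.9 Lemma smooth L2693–2698 with proof L2718–2732 (arXiv:1108.1335v2 TeX)] -/
theorem lemma22_mu_E {Φ : 𝒦 → F} {U : Set 𝒦} (hU : closedBall (0 : 𝒦) 1 ⊆ U) (hΦ : DifferentiableOn ℂ Φ U)
    {lam B ε : ℝ} (hA : ∀ x ∈ closedBall (0 : 𝒦) 1, ‖Φ x‖ ≤ B * lam ^ (3 / 4 - 4 * ε)) {E Edot : 𝒦}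
    (hE : ‖E‖ ≤ 1 / 2) (hEdot : ‖Edot‖ ≤ 1) :
    ‖deriv (fun t : ℂ => Φ (E + t • Edot)) 0‖ ≤ 2 * B * lam ^ (3 / 4 - 4 * ε) := by
  have h := norm_deriv_line_le hU hΦ hA hE hEdot
  linarith

/-- **LEMMA 22, `‖∂E*_k/∂E_k‖ ≤ 𝒪(1)L³λ_k^{1/4−10ε}`** (*"similar"*): `A = B·λ_k^{1/4−10ε}`. [cite: Dimock2013, §4.9 Lemma
smooth L2700–2702 with proof L2733 (arXiv:1108.1335v2 TeX)] -/
theorem lemma22_E_E {Φ : 𝒦 → F} {U : Set 𝒦} (hU : closedBall (0 : 𝒦) 1 ⊆ U) (hΦ : DifferentiableOn ℂ Φ U)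
    {lam B ε : ℝ} (hA : ∀ x ∈ closedBall (0 : 𝒦) 1, ‖Φ x‖ ≤ B * lam ^ (1 / 4 - 10 * ε)) {E Edot : 𝒦}
    (hE : ‖E‖ ≤ 1 / 2) (hEdot : ‖Edot‖ ≤ 1) :
    ‖deriv (fun t : ℂ => Φ (E + t • Edot)) 0‖ ≤ 2 * B * lam ^ (1 / 4 - 10 * ε) := by
  have h := norm_deriv_line_le hU hΦ hA hE hEdot
  linarith

/-! ### (v1.1) the operator norm: `‖∂/∂E_k‖ = sup_{‖Ė‖≤1} |<∂/∂E_k, Ė>|` -/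

/-- the directional derivative along `v` at `E` is the Fréchet derivative applied to `v`. [folklore] -/
private theorem deriv_line_eq_fderiv {Φ : 𝒦 → F} {E : 𝒦} (hΦ : DifferentiableAt ℂ Φ E) (v : 𝒦) :
    deriv (fun t : ℂ => Φ (E + t • v)) 0 = fderiv ℂ Φ E v := by
  have hline : HasDerivAt (fun t : ℂ => E + t • v) v 0 := by
    simpa using ((hasDerivAt_id (0 : ℂ)).smul_const v).const_add E
  have hΦ' : HasFDerivAt Φ (fderiv ℂ Φ E) (E + (0 : ℂ) • v) := by
    rw [zero_smul, add_zero]; exact hΦ.hasFDerivAt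
  exact (hΦ'.comp_hasDerivAt (0 : ℂ) hline).deriv

/-- **the operator-norm form** *"‖∂μ*_k/∂E_k‖ = sup_{‖Ė‖_{k,κ} ≤ 1} |<∂μ*_k/∂E_k, Ė>| ≤ 𝒪(1)L³λ_k^{3/4−4ε}"*: for `Φ`
differentiable on an OPEN `U` containing the closed unit ball of `𝒦`, `‖Φ‖ ≤ A` there and `‖E‖ ≤ ½`, the Fréchet
derivative has operator norm `‖DΦ(E)‖ ≤ 2A` (reading (ii) packaged: the directional bounds of `norm_deriv_line_le` for all
`‖Ė‖ ≤ 1`, rescaled). [cite: Dimock2013, §4.9 Lemma smooth proof L2728–2732 (arXiv:1108.1335v2 TeX)] -/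
theorem opNorm_fderiv_le {Φ : 𝒦 → F} {U : Set 𝒦} (hUo : IsOpen U) (hU : closedBall (0 : 𝒦) 1 ⊆ U)
    (hΦ : DifferentiableOn ℂ Φ U) {A : ℝ} (hA : ∀ x ∈ closedBall (0 : 𝒦) 1, ‖Φ x‖ ≤ A) {E : 𝒦} (hE : ‖E‖ ≤ 1 / 2) :
    ‖fderiv ℂ Φ E‖ ≤ 2 * A := by
  have hA0 : 0 ≤ A := (norm_nonneg _).trans (hA 0 (by simp))
  have hEU : E ∈ U := hU (by rw [mem_closedBall, dist_zero_right]; linarith)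
  have hdiff : DifferentiableAt ℂ Φ E := hΦ.differentiableAt (hUo.mem_nhds hEU)
  refine ContinuousLinearMap.opNorm_le_bound' _ (by linarith) fun v hv => ?_
  have hvpos : 0 < ‖v‖ := (norm_nonneg v).lt_of_ne (Ne.symm hv)
  -- the unit direction `Ė = v/‖v‖`
  set Edot : 𝒦 := (‖v‖⁻¹ : ℂ) • v with hEdot
  have hEdot1 : ‖Edot‖ ≤ 1 := by
    rw [hEdot, norm_smul, norm_inv, Complex.norm_real, Real.norm_eq_abs, abs_of_pos hvpos,
      inv_mul_cancel₀ hvpos.ne']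
  have hdir : ‖fderiv ℂ Φ E Edot‖ ≤ 2 * A := by
    rw [← deriv_line_eq_fderiv hdiff Edot]
    exact norm_deriv_line_le hU hΦ hA hE hEdot1
  have hv_eq : v = (‖v‖ : ℂ) • Edot := by
    rw [hEdot, smul_smul, mul_inv_cancel₀ (by exact_mod_cast hvpos.ne'), one_smul]
  calc ‖fderiv ℂ Φ E v‖ = ‖(‖v‖ : ℂ) • fderiv ℂ Φ E Edot‖ := by rw [hv_eq, map_smul, ← hv_eq]
    _ = ‖v‖ * ‖fderiv ℂ Φ E Edot‖ := by rw [norm_smul, Complex.norm_real, Real.norm_eq_abs, abs_of_pos hvpos]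
    _ ≤ ‖v‖ * (2 * A) := mul_le_mul_of_nonneg_left hdir (norm_nonneg _)
    _ = 2 * A * ‖v‖ := by ring

/-- **LEMMA 22's operator-norm statements** `‖∂μ*_k/∂E_k‖ ≤ 𝒪(1)L³λ_k^{3/4−4ε}`, `‖∂E*_k/∂E_k‖ ≤ 𝒪(1)L³λ_k^{1/4−10ε}`: with
`A = Bλ^a` the bound reads `‖DΦ(E)‖ ≤ 2Bλ^a` on `‖E‖ ≤ ½`. [cite: Dimock2013, §4.9 Lemma smooth L2693–2702 with proof
L2717–2733 (arXiv:1108.1335v2 TeX)] -/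
theorem lemma22_opNorm {Φ : 𝒦 → F} {U : Set 𝒦} (hUo : IsOpen U) (hU : closedBall (0 : 𝒦) 1 ⊆ U)
    (hΦ : DifferentiableOn ℂ Φ U) {lam B a : ℝ} (hA : ∀ x ∈ closedBall (0 : 𝒦) 1, ‖Φ x‖ ≤ B * lam ^ a) {E : 𝒦}
    (hE : ‖E‖ ≤ 1 / 2) : ‖fderiv ℂ Φ E‖ ≤ 2 * B * lam ^ a := by
  have h := opNorm_fderiv_le hUo hU hΦ hA hE
  linarith

end Directional

/-! ## §4 Instance -/

/-- the identity map on `ℂ` is analytic everywhere and bounded by `R` on the closed disc of radius `R = 4^{1/2} = 2`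
(`B = 1`, `a = 1/2`, `λ = 4`), so `deriv id μ = 1 ≤ 2·1·4^{0} = 2` for `|μ| ≤ 1`. -/
example {μ : ℂ} (hμ : ‖μ‖ ≤ (4 : ℝ) ^ (1 / 2 : ℝ) / 2) :
    ‖deriv (fun z : ℂ => z) μ‖ ≤ 2 * 1 * (4 : ℝ) ^ ((1 / 2 : ℝ) - 1 / 2) :=
  deriv_bound_rpow (f := fun z : ℂ => z) (by norm_num) differentiable_id.diffContOnCl
    (fun z hz => by rw [mem_closedBall, dist_zero_right] at hz; simpa using hz) hμ

end Literature.MathematicalPhysics.QuantumFieldTheory.Dimock2011to13.CauchyDerivativeBounds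

end
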